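import Mathlib
import HarnessLib
import HarnessLib.Audit
import Summits.PneNP.Statement
import Literature.Computability.Complexity.CNF
import Literature.Computability.Complexity.Classes
import Literature.Computability.Complexity.Nondeterministic
import Literature.Computability.MetaComplexity.Frege
import Literature.Computability.MetaComplexity.ProofSystems
import Literature.Computability.MetaComplexity.Resolution
import Summits.PneNP.PneNP.Theorems.ExpanderLinearGeneratorsTautBridge
import Summits.PneNP.PneNP.Theorems.ExpanderLinearGeneratorsAssemblyRev6
import HarnessLib.Audit.Status.Attr

/-!
Route: AperiodicTorus

# Route AperiodicTorus — holonomy without parity — climb the Cook–Reckhow ladder on torus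
tautologies of aperiodic Wang tile sets

It suffices to show X: TAUT has no polynomially bounded Cook–Reckhow proof system (equivalently NP ≠
coNP) — the SAME target as
route ProofCplx (item shared by signature), attacked by an ALTERNATIVE decomposition that realises
idea card
PneNP/PneNP/aperiodic-torus-tautologies: instead of Krajíček generators, climb the proof-system
ladder (LP/width → bounded-depth
Frege → Frege) on ONE new explicit, deterministic family of contradictions — τ(T,n) = "the Wang tile
set T tiles the n×n torus" for
tile sets T that tile the plane but no torus (aperiodic sets: Berger1966, Robinson1971, Kari1996,
JeandelRao2021). Their
unsatisfiability for EVERY n is global holonomy of the subshift X_T, and demanding all n provably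
excludes parity/linear tile sets
(those tile some tori), so these tautologies are 'holonomy without parity'; the route's bet is that
their proof complexity is
dictated by dynamical invariants of X_T (invariant measures ⇒ LP blindness; gluing ⇒ width;
hierarchy ⇒ bounded-depth upper bounds;
arithmetic cocycles ⇒ counting-type bounded-depth LOWER bounds) and that tile sets with
computationally deep period structure give
P-uniform Frege-hard candidates (crux #2), the rung where this line meets X.
Lean: `¬ Literature.Computability.MetaComplexity.HasPolyBoundedProofSystem
Literature.Computability.Complexity.TAUT`

## Assembly
Deciding theorem (D-0027 §2.1): `theorem closes (hX : NoPolyBoundedProofSystem) (hB : TautBridge) :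
PneNP := hB hX` — X plus
the support item TautBridge (X → PneNP over the tree's classes: if P = NP in Cook's Wave0 model
then, by the model bridges
P_bool_eq/NP_bool_eq and P ⊆ NP, Classes.P = NP, so coNP = co P = P = NP and TAUT ∈ NP has a
p-bounded proof system by
Cook–Reckhow Prop. 1.1; provable now from the discharged facts
NP_eq_coNP_iff_hasPolyBoundedProofSystem_TAUT_holds, co_P_holds,
P_bool_eq_holds, NP_bool_eq_holds, P_subset_NP_holds; the item is shared by signature with route
LyapunovRefutations). The former
ProofCplx-style Assembly over Literature named facts (item stmt-PneNP-0110) is restated here as the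
item `Assembly := NoPolyBoundedProofSystem → TautBridge → PneNP`
(the old item stays on ProofCplx): its hypotheses forced the route file to import
Complexity.ProofComplexity and Complexity.ClayProblem, homes of the
registered open conjectures EFNotPolyBounded and NPNotSubsetPPoly, which count as unproved cone
facts and blocked staffing, while
no crux or support of this route uses either file. The cruxes are RUNGS toward X (#2 sufficient for
the Frege rung, #3–#5 the
calibrating lower rungs); none is smuggled into the deciding theorem.

Rationale: WHY THIS LINE. Proof-size lower bounds above resolution are stuck on three instance sources (PHP,
Tseitin/parity, random CNF); the card supplies a
fourth with a dial: for a finite Wang tile set T the torus CNFs τ(T,n) are unsatisfiable for all n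
iff T has no periodic tiling
(JeandelVanier2020 §1.2: periodic ⇔ tiles some p×p torus), while every simply-connected region stays
tileable when T tiles the
plane — maximal local consistency with a reason of unsatisfiability set by the dynamics of X_T
rather than by linear algebra over
F_2 (DantchevRiis2001 'tiling games' and Alekhnovich's mutilated chessboard are parity principles;
nothing pairs APERIODICITY with
propositional proof complexity — see Novelty). Imported from symbolic dynamics: invariant
measures/compactness (JeandelVanier2020
Prop. 6), strong irreducibility and its limits (Lightwood2003: SI Z²-SFTs have dense periodic
points; Hochman2025: SI aperiodic
subshifts exist; GangloffSablik2021: quantified block gluing vs aperiodicity), the Kari–Culik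
multiplicative holonomy 2^a·3^(−b) ≠ 1
(Kari1996; JeandelVanier2020 Lemma 5) and Berger-type universality ('proving T aperiodic is
equivalent to proving P',
JeandelVanier2020 §1.2). Imported from proof complexity: the width game (AtseriasDalmau2008), grid
switching lemmas (Hastad2020,
HastadRisse2025) and the bounded-depth PHP template (KrajicekPudlakWoods1995, decl
boundedDepthFrege_pigeonhole_lowerBound).
What it does that ProofCplx/Proofcplx do not: it names explicit P-uniform hard-family candidates for
the Frege rung and files
unconditional theorem-candidates on the lower rungs that calibrate the dictionary. ENCODING (inlined
by `let`, identical in every item of this route): a Wang tile set is `t : ℕ` tiles with colours `τ s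
= (N, E, S, W) : ℕ×ℕ×ℕ×ℕ`; `tilesTorus n` := ∃ f : Fin n → Fin n → Fin t with E(f i j) = W(f i (j+1
mod n)) and S(f i j) = N(f (i+1 mod n) j); `torusCNF n : CNF ℕ` has variables x_(i,j,s) numbered
(i·n+j)·t+s ('cell (i,j) carries tile s') and clauses: per cell at-least-one and at-most-one tile;
for every cell and every pair (s,s′) with E(s) ≠ W(s′) the 2-clause ¬x_(i,j,s) ∨ ¬x_(i,j+1 mod
n,s′), and with S(s) ≠ N(s′) the 2-clause ¬x_(i,j,s) ∨ ¬x_(i+1 mod n,j,s′) (wrap-around included);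
`torusForm n := PropForm.neg (PropForm.ofCNF (torusCNF n))` is a tautology iff the n×n torus is
untileable. Planner's Sketch.lean (rc 0) checks the inlined terms are definitionally these helpers.

RANKED CRUXES. #0 NoPolyBoundedProofSystem (target) — No Cook–Reckhow proof system for TAUT is
polynomially bounded (NP ≠ coNP); identical to ProofCplx's target item (shared). (why it might fail:
X ⇔ NP ≠ coNP: false iff some proof system, however unnatural, is p-bounded; no superpolynomial
bound is known for any system from Frege up.) [CookReckhow1979, KrajicekProofComplexity2019]
#2 FregeHardAperiodicTorus (crux) — (card S6, the rung meeting X) There is a finite Wang tile set T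
that tiles no n×n torus (n ≥ 1) such that for every Frege system F and every k, for infinitely many
n every F-proof of the torus tautology torusForm n has size > n^k — an explicit P-uniform (indeed
tally) Frege-hard family; implies 'Frege is not p-bounded' (ProofCplx #3 / Proofcplx #2) via support
FregeHardGivesFregeNotPolyBounded. Where to look (card (iii)): Berger/Durand–Romashchenko–Shen-type
tile sets whose n-torus tilings would encode size-n^ε proofs of ⊥ in a system Frege does not
simulate, so that torusForm n is a consistency statement in disguise. [difficulty: open-problem]
(why it might fail: Every aperiodic T may have poly-size Frege non-periodicity proofs (Kari:
counting, Frege counts; hierarchical sets: induction on levels); a hard T must hide e.g. Con_EF(n)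
in its period structure, so this is as hard as any Frege lower bound (none known).)
[CookReckhow1979, KrajicekProofComplexity2019, JeandelVanier2020, DurandRomashchenkoShen2012,
Berger1966]
#3 DepthFregeHardAperiodicTorus (crux) — (card S5, the mechanism test) There is a finite Wang tile
set T tiling no torus such that for every depth d there are ε > 0 and N with: for n ≥ N every
depth-d textbookFrege proof of torusForm n has size ≥ 2^(n^ε) — the exact shape of
boundedDepthFrege_pigeonhole_lowerBound with PHP replaced by torus holonomy. Predicted witness: the
Kari–Culik-type set of JeandelVanier2020 §5.3 (rows multiply a balanced representation by 2 or 2/3;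
on a torus the row sums are positive integers with S_(i+1) = q_i·S_i exactly, so a tiling forces 2^a
= 3^b: an exact-counting contradiction with no parity, modulus or pigeon in its syntax). 'All n' is
essential: parity/linear tile sets tile some tori, so Håstad's grid-Tseitin bound gives nothing
here. [difficulty: XL] (why it might fail: Kari holonomy may be only a WEAK-counting principle:
approximate counting gives WPHP quasi-polynomial R(log)/bounded-depth proofs (Krajíček 2019 Thm
11.4.7); hierarchical sets look bounded-depth-easy (crux #4); no switching lemma for arithmetic
cocycles exists.) [Kari1996, JeandelVanier2020, Hastad2020, HastadRisse2025,
KrajicekPudlakWoods1995, PitassiBeameImpagliazzo1993, KrajicekProofComplexity2019]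
#4 DepthFregeEasyAperiodicTorus (crux) — (card S3/D3, 'rigid ⇒ easy') There is an APERIODIC Wang
tile set T (tiles the plane, tiles no torus) whose torus tautologies have polynomial-size
bounded-depth proofs: some fixed depth d and exponent c with a depth-d textbookFrege proof of
torusForm n of size ≤ n^c for every n ≥ 2. Predicted witnesses: self-similar sets (Robinson1971;
fixed-point sets, DurandRomashchenkoShen2012; the substitutive set of JeandelVanier2020 Prop. 8):
supertile phases are depth-2 definable and climb log n levels by local case analysis; n with odd
part dies at level 1 like an odd cycle. Together with #3 it shows the bounded-depth complexity of
aperiodicity ranges from polynomial to exponential according to the dynamics — the dictionary's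
content; its refutation (every aperiodic T is bounded-depth-hard) would be a uniform lower bound of
independent interest. [difficulty: XL] (why it might fail: For n = 2^m the level-m supertile is
torus-sized and 'phase' bookkeeping may need formulas of size n^(Ω(log n)) or depth growing with m;
even Robinson tori might need quasi-polynomial size at fixed depth.) [Robinson1971,
DurandRomashchenkoShen2012, JeandelVanier2020, Buss1987]
#5 AperiodicWidthHard (crux) — (card D2 made unconditional) There is an aperiodic Wang tile set T
(tiles the plane, no torus) and ε > 0 such that for all large n every resolution refutation of
torusCNF n has width ≥ ε·n — a width-hard aperiodic family (then tree-like size 2^Ω(n); the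
resolution rung of the ladder and the first kit-checkable prediction: Kari/Jeandel–Rao tori flexible
⇒ wide, Robinson tori odd-n narrow). Route to it: support GluingSubshiftWidth fires if X_T contains
a strongly irreducible subshift (open: Lightwood2003 forces periodic points only for SI SFTs;
Hochman2025 builds SI aperiodic subshifts), or a direct Duplicator strategy from Sturmian
flexibility of Kari rows. [difficulty: L] (why it might fail: Aperiodicity may force rigidity
visible at width o(n): GangloffSablik2021 shows o(log n)-block-gluing SFTs have periodic points, and
Lightwood's argument may extend to SFT envelopes of SI subshifts; Kari rows are zero-entropy (triage
flag on the card).) [AtseriasDalmau2008, BenSassonWigderson2001, Lightwood2003, Hochman2025,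
GangloffSablik2021, Kari1996]
#9 InvariantPairLaw (support) — (card S1/D1, provable now) If T tiles the plane then there are a
probability vector μ on tiles and nonnegative pair laws ρh, ρv on tile pairs, supported on
horizontally resp. vertically matching pairs, whose left/right (top/bottom) marginals all equal μ —
i.e. ONE translation-invariant feasible point of the basic LP relaxation of τ(T,n) for every n
simultaneously, so no plane-tiling T is ever refuted by BLP/arc-consistency. Proof: pair frequencies
in N×N square tilings have marginal defect O(1/N); extract a convergent subsequence
(JeandelVanier2020 Prop. 6 does this for colour balances; same compactness). [difficulty:
provable-now] [JeandelVanier2020, arXiv:1011.2442]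
#9 GluingSubshiftWidth (support) — (card D2 as a theorem) If the valid T-tilings of Z² contain a
nonempty shift-invariant family Y with finite-set gluing at sup-distance > g (strong irreducibility
with gap g, Hochman2025 §1.1, restricted to finite sets), then every resolution refutation π of
torusCNF n satisfies n ≤ g·(width(π)+2). Proof sketch (planner NOTES): Duplicator keeps, per cluster
of pebbled cells at torus sup-distance ≤ g, a faithful planar lift realised by some z ∈ Y (faithful
while k·g < n for k pebbled cells: congruent displacements of norm < n coincide); a new cell merges
clusters whose lifts are pairwise > g apart and are glued one by one inside Y; this
restriction-closed extendible family defeats every refutation of width ≤ k−1 (AtseriasDalmau2008,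
easy direction). By Lightwood2003 the hypothesis never holds with Y an SFT when T is aperiodic — the
statement is the engine behind crux #5, meaningful for non-aperiodic T (parity tiles: Tseitin
widths) and for SI sub-systems. [difficulty: M] [AtseriasDalmau2008, Hochman2025, Lightwood2003,
BenSassonWigderson2001]
#9 FregeHardGivesFregeNotPolyBounded (support) — (sanity glue, provable now) Crux #2 implies that no
Frege system is polynomially bounded: torusForm n is a tautology iff the n-torus is untileable
(encoding correctness of torusCNF — the real content of this item) and has size polynomial in n, so
a polynomial bound p(size) on F-proofs contradicts 'for every k, infinitely often all proofs exceed
n^k'. Certifies that the inline encoding says what the docstrings say and that #2 sits above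
ProofCplx #3. [difficulty: provable-now] [CookReckhow1979]
#9 TautBridge (support) — (route-repair 2026-08-15, provable now) X → PneNP over the tree's classes:
if P = NP then coNP = co P = P = NP (P_bool_eq, NP_bool_eq, P_subset_NP, co_P), so TAUT ∈ NP has a
p-bounded proof system (Cook–Reckhow Prop. 1.1); one Theorems file from
NP_eq_coNP_iff_hasPolyBoundedProofSystem_TAUT_holds, co_P_holds, P_bool_eq_holds, NP_bool_eq_holds,
P_subset_NP_holds (cf. the closes proof rendered in Theses/RamseyUncertifiable.lean and
Literature.CplxMeta.proofcplx_assembly). It replaces the ProofCplx-style Assembly item as the second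
hypothesis of the deciding theorem, so the route file needs neither Complexity.ProofComplexity nor
Complexity.ClayProblem. [difficulty: provable-now] [CookReckhow1979, AroraBarakCC2009]

TWO-LAYER PLAN. Foreseen glued splits, filed only after a crux closes or is taken up: #3 ⇐
(KariTorusUntileable: the JeandelVanier2020 §5.3 tile set,
written out, tiles no torus — Lemma 5) → (KariDepthLB: the depth-d lower bound for that explicit
set) → #3. #2 ⇐ (TorusUniversality:
for every proof system Q a tile set T_Q and short Frege proofs of torusForm_(T_Q) n ↔ Con_Q(n^ε)) →
(Frege does not p-simulate some Q on
a P-uniform family) → #2. #5 ⇐ GluingSubshiftWidth → (an aperiodic SFT containing an SI subshift, or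
a Sturmian Duplicator for Kari) → #5.

KILL CRITERIA. Refutation of #3 in the strong form 'every tile set tiling no torus has, for some
depth d, quasi-polynomial depth-d proofs' kills the
mechanism (holonomy is always weak counting/hierarchy) → close refuted:DepthFregeHardAperiodicTorus
unless #2 has independent life.
Refutation of #2 (every aperiodic T has p-size Frege non-periodicity proofs) closes the route: the
family cannot reach X's rung.
Refutation of #5 together with a proof of #4 for Kari-type sets ('flexible is also easy') demotes
the line to an instance catalogue →
close exhausted. ¬X (a p-bounded proof system) closes this route and ProofCplx alike. Refutation of
#4 alone does NOT close the route
(it would strengthen #3).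

NOT DECOMPOSED YET. The explicit Kari–Culik tile list (13–14 tiles; transducer rule aq + s = b + s′
of JeandelVanier2020 §5.3 — to be written out by the
prover of #3's first child, not guessed here); Sherali–Adams/SOS degree versions of D1 (no SA
hierarchy for CSP LPs in the tree);
Cutting Planes / TC⁰-Frege UPPER bounds for Kari tori (card S4; no CP system in the tree); the
universality construction T_Q and
the 'no optimal proof system' reading of 'hard for all systems' (belongs to card
no-p-optimal-proof-system); quantified-gluing
(GangloffSablik2021) refinements of GluingSubshiftWidth; kit experiments (SA LPs, CDCL width on n ≤
12 tori of Robinson/Kari/Jeandel–Rao).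

CHEAPEST FALSIFIER. Run the card's experiment (kit): generate torusCNF for the JeandelVanier2020
§5.3 Kari–Culik set and for Robinson's set, n ≤ 12;
if CDCL proof logs / k-consistency show Kari tori refuted at constant width (k = O(1)) the 'flexible
⇒ hard' direction (#5, and the
motivation of #3) dies in an afternoon; if Robinson tori at n = 2^m need width ~n, #4's heuristic
dies. By hand: check whether
(2,3)-consistency already refutes Kari tori for small n (the refuter triage notes odd cycles need
(2,3)-consistency). Not run here
(hub is compute-free for planners in this unit; no kit job submitted).

NUMBERS. Grid Tseitin, depth d: size ≥ 2^(n^Ω(1/d))-type bounds (Hastad2020; HastadRisse2025) — the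
target shape of #3. PHP template:
∀ d ∃ ε_d: size ≥ 2^(n^ε) (KrajicekPudlakWoods1995, PitassiBeameImpagliazzo1993; decl
boundedDepthFrege_pigeonhole_lowerBound).
WPHP_n^2n: size n^((log n)^O(1)) in R(log) (KrajicekProofComplexity2019 Thm 11.4.7) — the failure
mode of #3. Gluing: SI gap g ⇒
width ≥ n/g − 2 (GluingSubshiftWidth); o(log n)-block-gluing ⇒ periodic points, linear gluing
compatible with aperiodicity
(GangloffSablik2021); SI Z²-SFT ⇒ dense periodic points (Lightwood2003); SI aperiodic subshift with
gap 10 exists (Hochman2025 Thm 1.1).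
Smallest aperiodic Wang set: 11 tiles (JeandelRao2021); Kari1996: 14.

DEFINITION REQUESTS. Wanted in Literature/Dynamics (none exist in lean/): WangTileSet, plane/torus
tilings, the torus CNF, subshift of finite type,
strong irreducibility / block gluing; once landed, a tenure pass may `set-signature` the items to
the named forms (same meaning).
Filed after open as `--kind definition` requests tied to this route's items.

Novelty: Searches (2026-08-15, this planner; searchd local tier and OpenAlex/S2/arXiv were rate-limited or
resetting, zbMATH/Crossref/galaxy
answered): zbMATH 'Wang tiles proof complexity' (2 irrelevant), 'tiling tautologies Frege lower
bound' (0), 'aperiodic tile set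
resolution refutation' (0), 'periodic tiling problem NP-complete torus' (0), 'bounded depth Frege
Tseitin grid Håstad' (2:
HastadRisse2025, Galesi–Itsykson–Riazanov–Sofronova MFCS 2019), 'strongly irreducible shifts of
finite type periodic points' (1:
Hochman2025), 'block gluing aperiodicity entropy subshifts' (2: GangloffSablik2021 + preprint);
Crossref 'proof complexity of tiling
the torus with Wang tiles aperiodic' (tiling-graphics and JeandelRao2021 only); lit galaxy search
'tiling games' --star all (0
relevant; 'aperiodic tile set' saturated/queued); lit frontier PneNP --since 2020 (30 rows: EF/Frege
programme, Res(log) vs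
bounded-depth, nothing on tilings); lit bridges PneNP --cross any (no tiling bridge); lit read of
Hochman2025 pp.1–3, GangloffSablik2021
§1, JeandelVanier2020 §1.2–1.3, §5. Plus the card's and the refuter audit's searches
(DantchevRiis2001 §3 read: parity only).
Nearest prior art found: DantchevRiis2001 (tiling games on a board, impossibility by a dents/humps
PARITY restriction — Tseitin and
mutilated chessboard only); JeandelVanier2020 Prop. 6 (LP/colour-balance feasibility from plane
tilings = our support InvariantPairLaw
in weaker form); Hastad2020/HastadRisse2025 (bounded-depth lower bounds on  [refs: HastadRisse2025, Hochman2025, GangloffSablik2021, JeandelRao2021, JeandelVanier2020, DantchevRiis2001, Hastad2020]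

Barriers (technique_class: switching-lemma, pebble-games, symbolic-dynamics): - technique_class: switching-lemma, pebble-games, symbolic-dynamics
- Literature.Barriers.PneNP.FeasibleInterpolationEF: applies to the Frege rung (#2) exactly as for
ProofCplx — no interpolation-type method survives at Frege/EF under RSA; not evaded: #2 is a
candidate-family statement, and the bet is that hardness there comes from unprovability of the
encoded consistency statement (reflection), the one non-interpolation source known; rungs #3–#5
(bounded depth, resolution) are below the barrier's scope.
- Literature.Barriers.PneNP.NaturalProofs: does not formally apply to proof-size lower bounds (no
largeness/constructivity condition is forced); the families here are explicit and deterministic, not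
truth-table properties.
- Literature.Barriers.PneNP.Relativization: not engaged by #3–#5 (explicit CNFs, uniform proof
systems, combinatorial lower bounds do not relativize in the oracle sense); X itself implies P ≠ NP
and any eventual proof of X must be non-relativizing — inherited from ProofCplx, not specific to
this line.
- Literature.Barriers.PneNP.Algebrization: same status as Relativization (inherited at the level of
X only).
- Literature.Barriers.PneNP.Locality: the switching-lemma engine of #3 is the barrier's technique
class for CIRCUITS; for proof size of these explicit CNFs the locality/magnification obstruction
does not constrain the argument (Hastad2020 proves exactly such bounds on the grid); engaged as
engine, not obstacle.
- Negatives index: empty at filing (ledger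

Novelty grade: new-combination — ROUTE REVIEW (refuter H-73635f31, 2026-08-15). Grade concurs with the six card audits (new-combination: aperiodic SFT holonomy × Cook–Reckhow ladder); one uncited adjacent line added (Cavagnetto 2009/2011, via crossref; searchd/galaxy gave nothing else). FINDINGS: (1) all 9 decls elaborate by real i (refuter refuter-rreview-route-QuantumAdvantage-H-73635f31-0, 2026-08-15T12:21:04Z; prior: doi:10.1109/sfcs.2001.959896 Dantchev–Riis 2001 (tiling games = parity holonomy); Alekhnovich 2004 mutilated chessboard, JeandelVanier2020 §1.2 (periodic ⇔ torus), Prop 6 (weaker 2473), §5.3 Kari–Culik; Kari 1996; Jeandel–Rao 2021, Hastad 2020 / Hastad–Risse 2025 (depth-d Frege, grid Tseitin) — shape of 2470; KPW95 PHP template, Lightwood 2003; Hochman 2025; Gangloff–Sablik 2021 — engine/failure m)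

History (route lifecycle, newest last):
- 2026-08-15T16:21:49Z · rev 2: restated Assembly (stmt-PneNP-0110) — route-repair (cone guardrail + D-0027 glue), planner rbadge g2: (a) REROUTED AROUND both unproved cone facts — the route imported Complexity.ProofComplexity (ho (planner-rbadge-PneNP-AperiodicTorus-cf784286-g2-0)
- 2026-08-16T04:13:45Z · AUTO-CRUX (backfill): NoPolyBoundedProofSystem — hypotheses of the deciding theorem that nothing in the route derives are cruxes (operator:999:1085951)
- 2026-08-16T10:28:25Z · rev 3: restated Assembly (stmt-PneNP-10718 proved) — route-repair (ground-failed), planner rground: restated Assembly (stmt-PneNP-10718, kind assembly, closed·proved but flagged ground.trivial/tauto on the 2026-08 (planner-rground-PneNP-AperiodicTorus-cf784286-0)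
- 2026-08-23T21:08:26Z · DORMANT — reconciler: no traction for 6.2 d (last activity item-evidence-added at 2026-08-17T14:38:18Z); parked, not closed — `ledger route dormant route-PneNP-AperiodicT (operator:999:2708016)
- 2026-08-31T19:34:38Z · REACTIVATED (open) — reconciler: reactivated — activity statement-checked at 2026-08-31T18:52:19Z after parking at 2026-08-23T21:08:26Z (operator:999:822720)

sub-problem: PneNP · status: open · opened planner-plancard-PneNP-PneNP-aperiodic-torus--e97be530-0 2026-08-15T11:04:38Z · rev 3 · ledger route-PneNP-AperiodicTorus
GENERATED by the gate from the ledger (D-0016/17). Provers cite these decls: `theorem foo : Summit.PneNP.PneNP.Theses.AperiodicTorus.<Decl> := …` in Summits/PneNP/PneNP/Theorems/<Name>.lean.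
-/

namespace Summit.PneNP.PneNP.Theses.AperiodicTorus

open scoped BigOperators Topology Manifold Classical MeasureTheory ProbabilityTheory Matrix InnerProductSpace ComplexConjugate ContinuousMap
open Filter Set Function TopologicalSpace MeasureTheory

attribute [summit_statement] _root_.PneNP

open Literature.PNP

/-- item stmt-PneNP-0097 · crux (kind.auto-crux: conjecture-grade) · rank 0 · open · by planner
why it might fail: X ⇔ NP ≠ coNP: false iff some proof system, however unnatural, is p-bounded; no superpolynomial lower bound is known for any system from Frege up.
sources: CookReckhow1979, KrajicekProofComplexity2019
No Cook–Reckhow proof system for TAUT is polynomially bounded; equivalently NP ≠ coNP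
[CookReckhow1979, Prop. 1.1]. Route thesis of PneNP/ProofCplx. [sources: CookReckhow1979;
arXiv:2208.11642] -/
@[route_item "route-PneNP-AperiodicTorus", crux]
def NoPolyBoundedProofSystem : Prop :=
  ¬ Literature.Computability.MetaComplexity.HasPolyBoundedProofSystem Literature.Computability.Complexity.TAUT

/-- item stmt-PneNP-2469 · crux · rank 2 · open · by planner
why it might fail: False if Frege is p-bounded. Known aperiodic T look Frege-EASY: Kari–Culik tori have poly-size resolution refutations (log2(3n)+1 consecutive cyclic rows are jointly untileable by exact row sums, JeandelVanier2020 Lem.5), hierarchies fall to level induction; only consistency-encoding T remain.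
sources: CookReckhow1979, KrajicekProofComplexity2019, Buss1987, JeandelVanier2020, JeandelRao2021, DurandRomashchenkoShen2012
[crux] (card S6, the rung meeting X) There is a finite Wang tile set T that tiles no n×n torus (n ≥
1) such that for every Frege system F and every k, for infinitely many n every F-proof of the torus
tautology torusForm n has size > n^k — an explicit P-uniform (indeed tally) Frege-hard family;
implies 'Frege is not p-bounded' (ProofCplx #3 / Proofcplx #2) via support
FregeHardGivesFregeNotPolyBounded. Where to look (card (iii)): Berger/Durand–Romashchenko–Shen-type
tile sets whose n-torus tilings would encode size-n^ε proofs of ⊥ in a system Frege does not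
simulate, so that torusForm n is a consistency statement in disguise. [difficulty: open-problem] -/
@[route_item "route-PneNP-AperiodicTorus"]
def FregeHardAperiodicTorus : Prop :=
  ∃ (t : ℕ) (τ : Fin t → ℕ × ℕ × ℕ × ℕ), let tilesTorus : ℕ → Prop := (fun n : ℕ => ∃ f : Fin n → Fin n → Fin t, ∀ i j : Fin n, (τ (f i j)).2.1 = (τ (f i ⟨(j.1 + 1) % n, Nat.mod_lt _ j.pos⟩)).2.2.2 ∧ (τ (f i j)).2.2.1 = (τ (f ⟨(i.1 + 1) % n, Nat.mod_lt _ i.pos⟩ j)).1); let torusCNF : ℕ → Literature.Computability.Complexity.CNF ℕ := (fun n : ℕ => let v : Fin n → Fin n → Fin t → ℕ := fun i j s => (i.1 * n + j.1) * t + s.1; let nx : Fin n → Fin n := fun i => ⟨(i.1 + 1) % n, Nat.mod_lt _ i.pos⟩; let cells : List (Fin n × Fin n) := (List.finRange n).flatMap fun i => (List.finRange n).map fun j => (i, j); let prs : List (Fin t × Fin t) := (List.finRange t).flatMap fun s => (List.finRange t).map fun s' => (s, s'); (cells.map fun c => (List.finRange t).map fun s => (v c.1 c.2 s, true)) ++ (cells.flatMap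 fun c => (prs.filter fun q => decide (q.1 < q.2)).map fun q => [(v c.1 c.2 q.1, false), (v c.1 c.2 q.2, false)]) ++ (cells.flatMap fun c => (prs.filter fun q => decide ((τ q.1).2.1 ≠ (τ q.2).2.2.2)).map fun q => [(v c.1 c.2 q.1, false), (v c.1 (nx c.2) q.2, false)]) ++ (cells.flatMap fun c => (prs.filter fun q => decide ((τ q.1).2.2.1 ≠ (τ q.2).1)).map fun q => [(v c.1 c.2 q.1, false), (v (nx c.1) c.2 q.2, false)])); let torusForm : ℕ → Literature.Computability.Complexity.PropForm ℕ := fun n => Literature.Computability.Complexity.PropForm.neg (Literature.Computability.Complexity.PropForm.ofCNF (torusCNF n)); (∀ n ≥ 1, ¬ tilesTorus n) ∧ ∀ F : Literature.Computability.MetaComplexity.FregeSystem, Literature.Computability.MetaComplexity.IsFrege F → ∀ k N : ℕ, ∃ n ≥ N, ∀ π : List (Literature.Computability.Complexity.PropForm ℕ), F.IsProofOf π (torusForm n) → n ^ k < Literature.Computability.MetaComplexity.proofSize π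

/-- item stmt-PneNP-2470 · crux · rank 3 · open · by planner
why it might fail: Predicted Kari–Culik witness dies: log2(3n)+1 consecutive cyclic rows are untileable (2^m | S_m ≤ 3n), so a column sweep gives poly-size resolution refutations, all n; '∀ n ≥ N' also kills hierarchical T (odd n, N∤n: O(1)-height obstructions). Needs T with n^ε-tall cylinders at every n: none known.
sources: JeandelVanier2020, Kari1996, JeandelRao2021, AtseriasDalmau2008, Hastad2020, HastadRisse2025
[crux] (card S5, the mechanism test) There is a finite Wang tile set T tiling no torus such that for
every depth d there are ε > 0 and N with: for n ≥ N every depth-d textbookFrege proof of torusForm n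
has size ≥ 2^(n^ε) — the exact shape of boundedDepthFrege_pigeonhole_lowerBound with PHP replaced by
torus holonomy. Predicted witness: the Kari–Culik-type set of JeandelVanier2020 §5.3 (rows multiply
a balanced representation by 2 or 2/3; on a torus the row sums are positive integers with S_(i+1) =
q_i·S_i exactly, so a tiling forces 2^a = 3^b: an exact-counting contradiction with no parity,
modulus or pigeon in its syntax). 'All n' is essential: parity/linear tile sets tile some tori, so
Håstad's grid-Tseitin bound gives nothing here. [difficulty: XL] -/
@[route_item "route-PneNP-AperiodicTorus"]
def DepthFregeHardAperiodicTorus : Prop :=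
  ∃ (t : ℕ) (τ : Fin t → ℕ × ℕ × ℕ × ℕ), let tilesTorus : ℕ → Prop := (fun n : ℕ => ∃ f : Fin n → Fin n → Fin t, ∀ i j : Fin n, (τ (f i j)).2.1 = (τ (f i ⟨(j.1 + 1) % n, Nat.mod_lt _ j.pos⟩)).2.2.2 ∧ (τ (f i j)).2.2.1 = (τ (f ⟨(i.1 + 1) % n, Nat.mod_lt _ i.pos⟩ j)).1); let torusCNF : ℕ → Literature.Computability.Complexity.CNF ℕ := (fun n : ℕ => let v : Fin n → Fin n → Fin t → ℕ := fun i j s => (i.1 * n + j.1) * t + s.1; let nx : Fin n → Fin n := fun i => ⟨(i.1 + 1) % n, Nat.mod_lt _ i.pos⟩; let cells : List (Fin n × Fin n) := (List.finRange n).flatMap fun i => (List.finRange n).map fun j => (i, j); let prs : List (Fin t × Fin t) := (List.finRange t).flatMap fun s => (List.finRange t).map fun s' => (s, s'); (cells.map fun c => (List.finRange t).map fun s => (v c.1 c.2 s, true)) ++ (cells.flatMap fun c => (prs.filter fun q => decide (q.1 < q.2)).map fun q => [(v c.1 c.2 q.1, false), (v c.1 c.2 q.2, false)]) ++ (cells.flatMap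 fun c => (prs.filter fun q => decide ((τ q.1).2.1 ≠ (τ q.2).2.2.2)).map fun q => [(v c.1 c.2 q.1, false), (v c.1 (nx c.2) q.2, false)]) ++ (cells.flatMap fun c => (prs.filter fun q => decide ((τ q.1).2.2.1 ≠ (τ q.2).1)).map fun q => [(v c.1 c.2 q.1, false), (v (nx c.1) c.2 q.2, false)])); let torusForm : ℕ → Literature.Computability.Complexity.PropForm ℕ := fun n => Literature.Computability.Complexity.PropForm.neg (Literature.Computability.Complexity.PropForm.ofCNF (torusCNF n)); (∀ n ≥ 1, ¬ tilesTorus n) ∧ ∀ d : ℕ, ∃ ε : ℝ, 0 < ε ∧ ∃ N : ℕ, ∀ n ≥ N, ∀ π : List (Literature.Computability.Complexity.PropForm ℕ), Literature.Computability.MetaComplexity.textbookFrege.IsDepthProofOf d π (torusForm n) → (2 : ℝ) ^ ((n : ℝ) ^ ε) ≤ (Literature.Computability.MetaComplexity.proofSize π : ℝ)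

/-- item stmt-PneNP-2472 · crux · rank 5 · open · by planner
why it might fail: Kari/Culik tori have resolution width O(log n): log2(3n)+1 consecutive cyclic rows are jointly untileable (exact row sums, JeandelVanier2020 Lem.5), a band of pathwidth O(log n). Width εn for ALL large n needs an aperiodic T with εn-tall cylinders at every n; hierarchies fail at bad n; none known.
sources: JeandelVanier2020, Kari1996, JeandelRao2021, AtseriasDalmau2008, BenSassonWigderson2001, Lightwood2003
[crux] (card D2 made unconditional) There is an aperiodic Wang tile set T (tiles the plane, no
torus) and ε > 0 such that for all large n every resolution refutation of torusCNF n has width ≥ ε·n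
— a width-hard aperiodic family (then tree-like size 2^Ω(n); the resolution rung of the ladder and
the first kit-checkable prediction: Kari/Jeandel–Rao tori flexible ⇒ wide, Robinson tori odd-n
narrow). Route to it: support GluingSubshiftWidth fires if X_T contains a strongly irreducible
subshift (open: Lightwood2003 forces periodic points only for SI SFTs; Hochman2025 builds SI
aperiodic subshifts), or a direct Duplicator strategy from Sturmian flexibility of Kari rows.
[difficulty: L] -/
@[route_item "route-PneNP-AperiodicTorus"]
def AperiodicWidthHard : Prop :=
  ∃ (t : ℕ) (τ : Fin t → ℕ × ℕ × ℕ × ℕ), let tilesTorus : ℕ → Prop := (fun n : ℕ => ∃ f : Fin n → Fin n → Fin t, ∀ i j : Fin n, (τ (f i j)).2.1 = (τ (f i ⟨(j.1 + 1) % n, Nat.mod_lt _ j.pos⟩)).2.2.2 ∧ (τ (f i j)).2.2.1 = (τ (f ⟨(i.1 + 1) % n, Nat.mod_lt _ i.pos⟩ j)).1); let torusCNF : ℕ → Literature.Computability.Complexity.CNF ℕ := (fun n : ℕ => let v : Fin n → Fin n → Fin t → ℕ := fun i j s => (i.1 * n + j.1) * t + s.1; let nx : Fin n → Fin n := fun i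 => ⟨(i.1 + 1) % n, Nat.mod_lt _ i.pos⟩; let cells : List (Fin n × Fin n) := (List.finRange n).flatMap fun i => (List.finRange n).map fun j => (i, j); let prs : List (Fin t × Fin t) := (List.finRange t).flatMap fun s => (List.finRange t).map fun s' => (s, s'); (cells.map fun c => (List.finRange t).map fun s => (v c.1 c.2 s, true)) ++ (cells.flatMap fun c => (prs.filter fun q => decide (q.1 < q.2)).map fun q => [(v c.1 c.2 q.1, false), (v c.1 c.2 q.2, false)]) ++ (cells.flatMap fun c => (prs.filter fun q => decide ((τ q.1).2.1 ≠ (τ q.2).2.2.2)).map fun q => [(v c.1 c.2 q.1, false), (v c.1 (nx c.2) q.2, false)]) ++ (cells.flatMap fun c => (prs.filter fun q => decide ((τ q.1).2.2.1 ≠ (τ q.2).1)).map fun q => [(v c.1 c.2 q.1, false), (v (nx c.1) c.2 q.2, false)])); (∃ f : ℤ → ℤ → Fin t, ∀ i j : ℤ, (τ (f i j)).2.1 = (τ (f i (j + 1))).2.2.2 ∧ (τ (f i j)).2.2.1 = (τ (f (i + 1) j)).1) ∧ (∀ n ≥ 1, ¬ tilesTorus n) ∧ ∃ ε : ℝ,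 0 < ε ∧ ∃ N : ℕ, ∀ n ≥ N, ∀ π : List (Literature.Computability.MetaComplexity.ResLine ℕ), Literature.Computability.MetaComplexity.IsResRefutation (torusCNF n) π → ε * (n : ℝ) ≤ (Literature.Computability.MetaComplexity.resWidth π : ℝ)

/-- item stmt-PneNP-2471 · support · rank 4 · closed · proved by Summit.PneNP.PneNP.Theorems.aperiodicTorus_depthFregeEasyAperiodicTorus_proof @ acc8dac404b4 (prover) · by planner
why it might fail: For n = 2^m the level-m supertile is torus-sized and 'phase' bookkeeping may need formulas of size n^(Ω(log n)) or depth growing with m; even Robinson tori might need quasi-polynomial size at fixed depth.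
sources: JeandelVanier2020, Kari1996, JeandelRao2021, AtseriasDalmau2008, DurandRomashchenkoShen2012, Robinson1971
[crux] (card S3/D3, 'rigid ⇒ easy') There is an APERIODIC Wang tile set T (tiles the plane, tiles no
torus) whose torus tautologies have polynomial-size bounded-depth proofs: some fixed depth d and
exponent c with a depth-d textbookFrege proof of torusForm n of size ≤ n^c for every n ≥ 2.
Predicted witnesses: self-similar sets (Robinson1971; fixed-point sets, DurandRomashchenkoShen2012;
the substitutive set of JeandelVanier2020 Prop. 8): supertile phases are depth-2 definable and climb
log n levels by local case analysis; n with odd part dies at level 1 like an odd cycle. Together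
with #3 it shows the bounded-depth complexity of aperiodicity ranges from polynomial to exponential
according to the dynamics — the dictionary's content; its refutation (every aperiodic T is
bounded-depth-hard) would be a uniform lower bound of independent interest. [difficulty: XL] -/
@[route_item "route-PneNP-AperiodicTorus"]
def DepthFregeEasyAperiodicTorus : Prop :=
  ∃ (t : ℕ) (τ : Fin t → ℕ × ℕ × ℕ × ℕ), let tilesTorus : ℕ → Prop := (fun n : ℕ => ∃ f : Fin n → Fin n → Fin t, ∀ i j : Fin n, (τ (f i j)).2.1 = (τ (f i ⟨(j.1 + 1) % n, Nat.mod_lt _ j.pos⟩)).2.2.2 ∧ (τ (f i j)).2.2.1 = (τ (f ⟨(i.1 + 1) % n, Nat.mod_lt _ i.pos⟩ j)).1); let torusCNF : ℕ → Literature.Computability.Complexity.CNF ℕ := (fun n : ℕ => let v : Fin n → Fin n → Fin t → ℕ := fun i j s => (i.1 * n + j.1) * t + s.1; let nx : Fin n → Fin n := fun i => ⟨(i.1 + 1) % n, Nat.mod_lt _ i.pos⟩; let cells : List (Fin n × Fin n) := (List.finRange n).flatMap fun i => (List.finRange n).map fun j => (i, j); let prs : List (Fin t × Fin t) := (List.finRange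 t).flatMap fun s => (List.finRange t).map fun s' => (s, s'); (cells.map fun c => (List.finRange t).map fun s => (v c.1 c.2 s, true)) ++ (cells.flatMap fun c => (prs.filter fun q => decide (q.1 < q.2)).map fun q => [(v c.1 c.2 q.1, false), (v c.1 c.2 q.2, false)]) ++ (cells.flatMap fun c => (prs.filter fun q => decide ((τ q.1).2.1 ≠ (τ q.2).2.2.2)).map fun q => [(v c.1 c.2 q.1, false), (v c.1 (nx c.2) q.2, false)]) ++ (cells.flatMap fun c => (prs.filter fun q => decide ((τ q.1).2.2.1 ≠ (τ q.2).1)).map fun q => [(v c.1 c.2 q.1, false), (v (nx c.1) c.2 q.2, false)])); let torusForm : ℕ → Literature.Computability.Complexity.PropForm ℕ := fun n => Literature.Computability.Complexity.PropForm.neg (Literature.Computability.Complexity.PropForm.ofCNF (torusCNF n)); (∃ f : ℤ → ℤ → Fin t, ∀ i j : ℤ, (τ (f i j)).2.1 = (τ (f i (j + 1))).2.2.2 ∧ (τ (f i j)).2.2.1 = (τ (f (i + 1) j)).1) ∧ (∀ n ≥ 1, ¬ tilesTorus n) ∧ ∃ d c : ℕ, ∀ n ≥ 2, ∃ π : List (Literature.Computability.Complexity.PropForm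 ℕ), Literature.Computability.MetaComplexity.textbookFrege.IsDepthProofOf d π (torusForm n) ∧ Literature.Computability.MetaComplexity.proofSize π ≤ n ^ c

-- `DepthFregeEasyAperiodicTorus` holds: proved by `Summit.PneNP.PneNP.Theorems.aperiodicTorus_depthFregeEasyAperiodicTorus_proof` @ acc8dac404b4 (its module imports this route file, so no `_holds` link can be stated here).

/-- item stmt-PneNP-10249 · support · rank 9 · closed · proved by Summit.PneNP.PneNP.Theorems.tautBridge_proof @ d852aa9184c8 (prover) · by planner
sources: CookReckhow1979, AroraBarakCC2009
[support] X → PneNP over the tree's classes: if P = NP then coNP = co P = P ⊆ NP, so TAUT ∈ NP has a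
p-bounded proof system (Cook–Reckhow general form). Provable now from
hasPolyBoundedProofSystem_iff_mem_NP_holds, TAUT_mem_coNP_holds, co_P_holds, P_bool_eq_holds,
NP_bool_eq_holds, P_subset_NP_holds (cf. Literature.CplxMeta.proofcplx_assembly). [difficulty:
provable-now] -/
@[route_item "route-PneNP-AperiodicTorus", crux]
def TautBridge : Prop :=
  ¬ Literature.Computability.MetaComplexity.HasPolyBoundedProofSystem Literature.Computability.Complexity.TAUT → PneNP

/-- `TautBridge` holds: proved by `Summit.PneNP.PneNP.Theorems.tautBridge_proof` @ d852aa9184c8. -/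
theorem TautBridge_holds : TautBridge := _root_.Summit.PneNP.PneNP.Theorems.tautBridge_proof

/-- item stmt-PneNP-2473 · support · rank 9 · closed · proved by Summit.PneNP.PneNP.Theorems.aperiodicTorus_invariantPairLaw_proof @ 3f171974f2c2 (prover) · by planner
sources: JeandelVanier2020, arXiv:1011.2442
[support] (card S1/D1, provable now) If T tiles the plane then there are a probability vector μ on
tiles and nonnegative pair laws ρh, ρv on tile pairs, supported on horizontally resp. vertically
matching pairs, whose left/right (top/bottom) marginals all equal μ — i.e. ONE translation-invariant
feasible point of the basic LP relaxation of τ(T,n) for every n simultaneously, so no plane-tiling T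
is ever refuted by BLP/arc-consistency. Proof: pair frequencies in N×N square tilings have marginal
defect O(1/N); extract a convergent subsequence (JeandelVanier2020 Prop. 6 does this for colour
balances; same compactness). [difficulty: provable-now] -/
@[route_item "route-PneNP-AperiodicTorus"]
def InvariantPairLaw : Prop :=
  ∀ (t : ℕ) (τ : Fin t → ℕ × ℕ × ℕ × ℕ), (∃ f : ℤ → ℤ → Fin t, ∀ i j : ℤ, (τ (f i j)).2.1 = (τ (f i (j + 1))).2.2.2 ∧ (τ (f i j)).2.2.1 = (τ (f (i + 1) j)).1) → ∃ (μ : Fin t → ℝ) (ρh ρv : Fin t → Fin t → ℝ), (∀ s, 0 ≤ μ s) ∧ ∑ s, μ s = 1 ∧ (∀ s s', 0 ≤ ρh s s' ∧ 0 ≤ ρv s s') ∧ (∀ s, ∑ s', ρh s s' = μ s ∧ ∑ s', ρh s' s = μ s ∧ ∑ s', ρv s s' = μ s ∧ ∑ s', ρv s' s = μ s) ∧ (∀ s s', ρh s s' ≠ 0 → (τ s).2.1 = (τ s').2.2.2) ∧ (∀ s s', ρv s s' ≠ 0 → (τ s).2.2.1 = (τ s').1)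

-- `InvariantPairLaw` holds: proved by `Summit.PneNP.PneNP.Theorems.aperiodicTorus_invariantPairLaw_proof` @ 3f171974f2c2 (its module imports this route file, so no `_holds` link can be stated here).

/-- item stmt-PneNP-2474 · support · rank 9 · closed · proved by Summit.PneNP.PneNP.Theorems.aperiodicTorus_gluingSubshiftWidth_proof @ d3a9ed1ae004 (prover) · by planner
sources: AtseriasDalmau2008, Hochman2025, Lightwood2003, BenSassonWigderson2001
[support] (card D2 as a theorem) If the valid T-tilings of Z² contain a nonempty shift-invariant
family Y with finite-set gluing at sup-distance > g (strong irreducibility with gap g, Hochman2025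
§1.1, restricted to finite sets), then every resolution refutation π of torusCNF n satisfies n ≤
g·(width(π)+2). Proof sketch (planner NOTES): Duplicator keeps, per cluster of pebbled cells at
torus sup-distance ≤ g, a faithful planar lift realised by some z ∈ Y (faithful while k·g < n for k
pebbled cells: congruent displacements of norm < n coincide); a new cell merges clusters whose lifts
are pairwise > g apart and are glued one by one inside Y; this restriction-closed extendible family
defeats every refutation of width ≤ k−1 (AtseriasDalmau2008, easy direction). By Lightwood2003 the
hypothesis never holds with Y an SFT when T is aperiodic — the statement is the engine behind crux
#5, meaningful for non-aperiodic T (parity tiles: Tseitin widths) and for SI sub-systems.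
[difficulty: M] -/
@[route_item "route-PneNP-AperiodicTorus"]
def GluingSubshiftWidth : Prop :=
  ∀ (t : ℕ) (τ : Fin t → ℕ × ℕ × ℕ × ℕ) (g : ℕ), let torusCNF : ℕ → Literature.Computability.Complexity.CNF ℕ := (fun n : ℕ => let v : Fin n → Fin n → Fin t → ℕ := fun i j s => (i.1 * n + j.1) * t + s.1; let nx : Fin n → Fin n := fun i => ⟨(i.1 + 1) % n, Nat.mod_lt _ i.pos⟩; let cells : List (Fin n × Fin n) := (List.finRange n).flatMap fun i => (List.finRange n).map fun j => (i, j); let prs : List (Fin t × Fin t) := (List.finRange t).flatMap fun s => (List.finRange t).map fun s' => (s, s'); (cells.map fun c => (List.finRange t).map fun s => (v c.1 c.2 s, true)) ++ (cells.flatMap fun c => (prs.filter fun q => decide (q.1 < q.2)).map fun q => [(v c.1 c.2 q.1, false), (v c.1 c.2 q.2, false)]) ++ (cells.flatMap fun c => (prs.filter fun q => decide ((τ q.1).2.1 ≠ (τ q.2).2.2.2)).map fun q => [(v c.1 c.2 q.1, false), (v c.1 (nx c.2) q.2, false)]) ++ (cells.flatMap fun c => (prs.filter fun q => decide ((τ q.1).2.2.1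 ≠ (τ q.2).1)).map fun q => [(v c.1 c.2 q.1, false), (v (nx c.1) c.2 q.2, false)])); (∃ Y : Set (ℤ → ℤ → Fin t), Y.Nonempty ∧ (∀ x ∈ Y, ∀ i j : ℤ, (τ (x i j)).2.1 = (τ (x i (j + 1))).2.2.2 ∧ (τ (x i j)).2.2.1 = (τ (x (i + 1) j)).1) ∧ (∀ x ∈ Y, ∀ a b : ℤ, (fun i j => x (i + a) (j + b)) ∈ Y) ∧ (∀ E F : Finset (ℤ × ℤ), (∀ p ∈ E, ∀ q ∈ F, (g : ℤ) < max |p.1 - q.1| |p.2 - q.2|) → ∀ x ∈ Y, ∀ y ∈ Y, ∃ z ∈ Y, (∀ p ∈ E, z p.1 p.2 = x p.1 p.2) ∧ (∀ q ∈ F, z q.1 q.2 = y q.1 q.2))) → ∀ n ≥ 1, ∀ π : List (Literature.Computability.MetaComplexity.ResLine ℕ), Literature.Computability.MetaComplexity.IsResRefutation (torusCNF n) π → n ≤ g * (Literature.Computability.MetaComplexity.resWidth π + 2)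

-- `GluingSubshiftWidth` holds: proved by `Summit.PneNP.PneNP.Theorems.aperiodicTorus_gluingSubshiftWidth_proof` @ d3a9ed1ae004 (its module imports this route file, so no `_holds` link can be stated here).

/-- item stmt-PneNP-2475 · support · rank 9 · closed · proved by Summit.PneNP.PneNP.Theorems.aperiodicTorus_fregeHardGivesFregeNotPolyBounded_proof @ 5c5f65a3e903 (prover) · by planner
sources: CookReckhow1979
[support] (sanity glue, provable now) Crux #2 implies that no Frege system is polynomially bounded:
torusForm n is a tautology iff the n-torus is untileable (encoding correctness of torusCNF — the
real content of this item) and has size polynomial in n, so a polynomial bound p(size) on F-proofs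
contradicts 'for every k, infinitely often all proofs exceed n^k'. Certifies that the inline
encoding says what the docstrings say and that #2 sits above ProofCplx #3. [difficulty:
provable-now] -/
@[route_item "route-PneNP-AperiodicTorus"]
def FregeHardGivesFregeNotPolyBounded : Prop :=
  (∃ (t : ℕ) (τ : Fin t → ℕ × ℕ × ℕ × ℕ), let tilesTorus : ℕ → Prop := (fun n : ℕ => ∃ f : Fin n → Fin n → Fin t, ∀ i j : Fin n, (τ (f i j)).2.1 = (τ (f i ⟨(j.1 + 1) % n, Nat.mod_lt _ j.pos⟩)).2.2.2 ∧ (τ (f i j)).2.2.1 = (τ (f ⟨(i.1 + 1) % n, Nat.mod_lt _ i.pos⟩ j)).1); let torusCNF : ℕ → Literature.Computability.Complexity.CNF ℕ := (fun n : ℕ => let v : Fin n → Fin n → Fin t → ℕ := fun i j s => (i.1 * n + j.1) * t + s.1; let nx : Fin n → Fin n := fun i => ⟨(i.1 + 1) % n, Nat.mod_lt _ i.pos⟩; let cells : List (Fin n × Fin n) := (List.finRange n).flatMap fun i => (List.finRange n).map fun j => (i, j); let prs : List (Fin t × Fin t) := (List.finRange t).flatMap fun s => (List.finRange t).map fun s'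 => (s, s'); (cells.map fun c => (List.finRange t).map fun s => (v c.1 c.2 s, true)) ++ (cells.flatMap fun c => (prs.filter fun q => decide (q.1 < q.2)).map fun q => [(v c.1 c.2 q.1, false), (v c.1 c.2 q.2, false)]) ++ (cells.flatMap fun c => (prs.filter fun q => decide ((τ q.1).2.1 ≠ (τ q.2).2.2.2)).map fun q => [(v c.1 c.2 q.1, false), (v c.1 (nx c.2) q.2, false)]) ++ (cells.flatMap fun c => (prs.filter fun q => decide ((τ q.1).2.2.1 ≠ (τ q.2).1)).map fun q => [(v c.1 c.2 q.1, false), (v (nx c.1) c.2 q.2, false)])); let torusForm : ℕ → Literature.Computability.Complexity.PropForm ℕ := fun n => Literature.Computability.Complexity.PropForm.neg (Literature.Computability.Complexity.PropForm.ofCNF (torusCNF n)); (∀ n ≥ 1, ¬ tilesTorus n) ∧ ∀ F : Literature.Computability.MetaComplexity.FregeSystem, Literature.Computability.MetaComplexity.IsFrege F → ∀ k N : ℕ, ∃ n ≥ N, ∀ π : List (Literature.Computability.Complexity.PropForm ℕ), F.IsProofOf π (torusForm n) → n ^ k < Literature.Computability.MetaComplexity.proofSize π) → ∀ F : Literature.Computability.MetaComplexity.FregeSystem,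 Literature.Computability.MetaComplexity.IsFrege F → ¬ F.IsPolyBounded

-- `FregeHardGivesFregeNotPolyBounded` holds: proved by `Summit.PneNP.PneNP.Theorems.aperiodicTorus_fregeHardGivesFregeNotPolyBounded_proof` @ 5c5f65a3e903 (its module imports this route file, so no `_holds` link can be stated here).

-- earlier Assembly (stmt-PneNP-0110, replaced 2026-08-15T16:21:49Z -> stmt-PneNP-10718): retired by None — Literature.Computability.Complexity.NP_eq_coNP_iff_hasPolyBoundedProofSystem_TAUT → Literature.Computability.Complexity.co_P → Literature.Computability.Complexity.P_bool_eq → Literature.Computability.Complexity.NP_bool_eq → Literature.Computability.Complexity.P_subset_NP → ¬ Literature.Computab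
-- earlier Assembly (stmt-PneNP-10718, replaced 2026-08-16T10:28:25Z -> stmt-PneNP-15165): proved by Summit.PneNP.PneNP.Theorems.expanderLinearGenerators_assembly_proof — NoPolyBoundedProofSystem → TautBridge → PneNP
/-- item stmt-PneNP-15165 · assembly · rank 1 · closed · proved by Summit.PneNP.PneNP.Theorems.expanderLinearGenerators_assembly_rev6_proof @ 865910586a2c (prover) · by planner
sources: CookReckhow1979
[assembly] NoPolyBoundedProofSystem → PneNP: the route's single crux X (no polynomially bounded
Cook–Reckhow proof system for TAUT, i.e. NP ≠ coNP; stmt-PneNP-0097) implies the summit statement.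
Restated 2026-08-16 (route-repair rev 5, ground.trivial) from `NoPolyBoundedProofSystem → TautBridge
→ PneNP` (stmt-PneNP-10718, kept by AperiodicTorus / MatroidTseitin), which is literally the type of
`closes (hX) (hB) := hB hX` and hence a propositional tautology over the route's own items
(`tauto`). The restated form carries the real content X ⇒ summit and is DEFINITIONALLY the PROVED
bridge item TautBridge (stmt-PneNP-10249 = route ProofCplx's assembly; `example :
(NoPolyBoundedProofSystem → PneNP) = TautBridge := rfl` checks rc 0): a prover closes it in a
Theorems file by `theorem … : Summit.PneNP.PneNP.Theses.ExpanderLinearGenerators.Assembly :=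
Summit.PneNP.PneNP.Theorems.tautBridge_proof` (import
Summits.PneNP.PneNP.Theorems.ExpanderLinearGeneratorsTautBridge) or `:= fun hX =>
Summit.PneNP.PneNP.Theses.ExpanderLinearGenerators.closes hX
Summit.PneNP.PneNP.Theorems.tautBridge_proof`. The deciding theorem `closes` is unchanged.
[difficulty: provable-now] [CookReckhow1979, AroraBarakCC -/
@[route_item "route-PneNP-AperiodicTorus"]
def Assembly : Prop :=
  NoPolyBoundedProofSystem → PneNP

/-- `Assembly` holds: proved by `Summit.PneNP.PneNP.Theorems.expanderLinearGenerators_assembly_rev6_proof` @ 865910586a2c. -/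
theorem Assembly_holds : Assembly := _root_.Summit.PneNP.PneNP.Theorems.expanderLinearGenerators_assembly_rev6_proof

/-! D-0027 §2.1 — DECIDING THEOREM (planner-authored via `route open/edit --closes-file`; by planner-rbadge-PneNP-AperiodicTorus-cf784286-g2-0 2026-08-15T16:21:49Z):
its hypotheses are this route's items and its conclusion the sub-problem Statement (glue_lint), and it elaborates with this file. -/

@[closes "route-PneNP-AperiodicTorus"] theorem closes (hX : NoPolyBoundedProofSystem) (hB : TautBridge) : _root_.PneNP := hB hX

end Summit.PneNP.PneNP.Theses.AperiodicTorus
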